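import Summits.CriticalPhenomena.CardyFormulaZ2.Theorems.CardySelfRefinementCriticalPathRSWStubFiniteSizeCriteriaGeometry

/-!
# Finite-size criteria for `M_k`, part 2: the four rectangles of an annulus, monotonicity and
symmetries of crossing events

Support file for item `stmt-CriticalPhenomena-10267` (route `CardySelfRefinement`, crux
`CriticalPathRSW`, line finite-size-envelope, stub `stub_finiteSizeCriteria`): the finite-size
criteria (H. Kesten, *Percolation theory for mathematicians* (1982), Ch. 5, Thm. 5.1; G. Grimmett,
*Percolation* (1999), §11.7) for the `k`-dependent self-refinement laws `M_k(ρ, c)` and their duals.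

Path-wise facts on `ℤ²` (lattice configurations `ω ⊆ E(ℤ²)`), continuing part 1:

* `annulusCross_subset_union` — an annulus `A(c; N, R)` is crossed only if one of the four
  `(R - N) × 2R` rectangles around it is crossed the short way (Kesten 1982, Ch. 5);
* `hCross_mono` — a horizontal crossing of a rectangle contains a horizontal crossing of every
  narrower and taller rectangle;
* the action of translations and of the transposition of the axes on rectangles and crossing
  events (`preimage_shift_hCross`, `preimage_shift_annulusCross`, `preimage_transpose_hCross`).
-/

noncomputable section

namespace Summit.CriticalPhenomena.CardyFormulaZ2.Cruxes.CriticalPathRSW.FiniteSizeEnvelope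

open Set
open Literature.Probability.LatticeModels Literature.Probability.Percolation

namespace FSC

/-! ### Rectangles and crossing events (local notations)

To keep these support files free of new definitions, the four events of the argument are local
notations for explicit instances of the tree's `openCrossing S A B`:

* `rect[a, b, lo, hi]` — the lattice rectangle `[a, b] × [lo, hi] ∩ ℤ²` (a `Finset`, Mathlib's
  order interval of `Site 2 = Fin 2 → ℤ`);
* `hCross[a, b, lo, hi]` — its **horizontal open crossing**: an open path inside the rectangle from
  the left side `{x₀ = a}` to the right side `{x₀ = b}`;
* `vCross[a, b, lo, hi]` — its **vertical open crossing**, from `{x₁ = lo}` to `{x₁ = hi}`;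
* `annulusCross[c, N, R]` — the **annulus event** `A(c; N, R)` of Kesten (1982), Ch. 5: an open
  path inside the box `c + [-R, R]²` from the box `c + [-N, N]²` to the boundary of `c + [-R, R]²`. -/

local notation3 "rect[" a ", " b ", " lo ", " hi "]" =>
  (Finset.Icc ![(a : ℤ), (lo : ℤ)] ![(b : ℤ), (hi : ℤ)] : Finset (Site 2))

local notation3 "hCross[" a ", " b ", " lo ", " hi "]" =>
  (openCrossing (↑(Finset.Icc ![(a : ℤ), (lo : ℤ)] ![(b : ℤ), (hi : ℤ)] : Finset (Site 2)) : Set (Site 2))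
    {x : Site 2 | x ∈ (Finset.Icc ![(a : ℤ), (lo : ℤ)] ![(b : ℤ), (hi : ℤ)] : Finset (Site 2)) ∧ x 0 = (a : ℤ)}
    {x : Site 2 | x ∈ (Finset.Icc ![(a : ℤ), (lo : ℤ)] ![(b : ℤ), (hi : ℤ)] : Finset (Site 2)) ∧ x 0 = (b : ℤ)} :
    Set (BondConfig (Site 2)))

local notation3 "vCross[" a ", " b ", " lo ", " hi "]" =>
  (openCrossing (↑(Finset.Icc ![(a : ℤ), (lo : ℤ)] ![(b : ℤ), (hi : ℤ)] : Finset (Site 2)) : Set (Site 2))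
    {x : Site 2 | x ∈ (Finset.Icc ![(a : ℤ), (lo : ℤ)] ![(b : ℤ), (hi : ℤ)] : Finset (Site 2)) ∧ x 1 = (lo : ℤ)}
    {x : Site 2 | x ∈ (Finset.Icc ![(a : ℤ), (lo : ℤ)] ![(b : ℤ), (hi : ℤ)] : Finset (Site 2)) ∧ x 1 = (hi : ℤ)} :
    Set (BondConfig (Site 2)))

local notation3 "annulusCross[" c ", " N ", " R "]" =>
  (openCrossing
    (↑(Finset.Icc ![(c : Site 2) 0 - ((R : ℕ) : ℤ), (c : Site 2) 1 - ((R : ℕ) : ℤ)]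
        ![(c : Site 2) 0 + ((R : ℕ) : ℤ), (c : Site 2) 1 + ((R : ℕ) : ℤ)] : Finset (Site 2)) : Set (Site 2))
    (↑(Finset.Icc ![(c : Site 2) 0 - ((N : ℕ) : ℤ), (c : Site 2) 1 - ((N : ℕ) : ℤ)]
        ![(c : Site 2) 0 + ((N : ℕ) : ℤ), (c : Site 2) 1 + ((N : ℕ) : ℤ)] : Finset (Site 2)) : Set (Site 2))
    {x : Site 2 | x ∈ (Finset.Icc ![(c : Site 2) 0 - ((R : ℕ) : ℤ), (c : Site 2) 1 - ((R : ℕ) : ℤ)]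
        ![(c : Site 2) 0 + ((R : ℕ) : ℤ), (c : Site 2) 1 + ((R : ℕ) : ℤ)] : Finset (Site 2)) ∧
      (x 0 = (c : Site 2) 0 - ((R : ℕ) : ℤ) ∨ x 0 = (c : Site 2) 0 + ((R : ℕ) : ℤ) ∨
        x 1 = (c : Site 2) 1 - ((R : ℕ) : ℤ) ∨ x 1 = (c : Site 2) 1 + ((R : ℕ) : ℤ))} :
    Set (BondConfig (Site 2)))


/-! ### The four rectangles of an annulus -/

/-- **An annulus is crossed only if one of four rectangles is crossed the short way**: on a
lattice configuration, `A(c; N, R) ⊆ H⁺ ∪ H⁻ ∪ V⁺ ∪ V⁻`, the horizontal crossings of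
`[c₀ + N, c₀ + R] × [c₁ - R, c₁ + R]`, `[c₀ - R, c₀ - N] × [c₁ - R, c₁ + R]` and the vertical
crossings of `[c₀ - R, c₀ + R] × [c₁ + N, c₁ + R]`, `[c₀ - R, c₀ + R] × [c₁ - R, c₁ - N]`
(Kesten 1982, Ch. 5; cut the path at its last visit to the inner slab). -/
theorem annulusCross_subset_union {ω : BondConfig (Site 2)} (hω : ω ⊆ (zdGraph 2).edgeSet)
    {c : Site 2} {N R : ℕ} (hNR : N < R) (h : ω ∈ annulusCross[c, N, R]) :
    ω ∈ hCross[(c 0 + N), (c 0 + R), (c 1 - R), (c 1 + R)] ∨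
      ω ∈ hCross[(c 0 - R), (c 0 - N), (c 1 - R), (c 1 + R)] ∨
      ω ∈ vCross[(c 0 - R), (c 0 + R), (c 1 + N), (c 1 + R)] ∨
      ω ∈ vCross[(c 0 - R), (c 0 + R), (c 1 - R), (c 1 - N)] := by
  obtain ⟨s, hs, e, ⟨heR, hesph⟩, hconn⟩ := h
  obtain ⟨w, hwS, hwω⟩ := exists_walk_of_mem_openConnIn hω hconn
  rw [Finset.mem_coe, mem_rect] at hs
  rw [mem_rect] at heR
  have hNR' : (N : ℤ) < R := by exact_mod_cast hNR
  have hwS' : ∀ t ∈ w.support, c 0 - R ≤ t 0 ∧ t 0 ≤ c 0 + R ∧ c 1 - R ≤ t 1 ∧ t 1 ≤ c 1 + R :=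
    fun t ht => mem_rect.1 (Finset.mem_coe.1 (hwS t ht))
  rcases hesph with he | he | he | he
  · -- exit through the left side: last visit to `{x₀ ≥ c₀ - N}`
    right; left
    obtain ⟨a, p, ha, hp, hpe⟩ := exists_tail_walk (fun x : Site 2 => -x 0)
      (fun x y h => by have := (sub_le_one_of_adj h 0).2; omega) w
      (n := -(c 0 - N)) (by omega) (by omega)
    have hpS : ∀ t ∈ p.support, t ∈ (↑(rect[(c 0 - R), (c 0 - N), (c 1 - R), (c 1 + R)]) : Set (Site 2)) := by
      intro t ht
      obtain ⟨h1, h2⟩ := hp t ht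
      have := hwS' t h2
      exact Finset.mem_coe.2 (mem_rect.2 (by omega))
    refine ⟨e, ⟨Finset.mem_coe.1 (hpS e p.end_mem_support), he⟩, a,
      ⟨Finset.mem_coe.1 (hpS a p.start_mem_support), by omega⟩, ?_⟩
    rw [openConnIn_comm]
    exact mem_openConnIn_of_walk p hpS fun x hx => hwω x (hpe x hx)
  · -- exit through the right side: last visit to `{x₀ ≤ c₀ + N}`
    left
    obtain ⟨a, p, ha, hp, hpe⟩ := exists_tail_walk (fun x : Site 2 => x 0)
      (fun x y h => by have := (sub_le_one_of_adj h 0).1; omega) w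
      (n := c 0 + N) (by omega) (by omega)
    have hpS : ∀ t ∈ p.support, t ∈ (↑(rect[(c 0 + N), (c 0 + R), (c 1 - R), (c 1 + R)]) : Set (Site 2)) := by
      intro t ht
      obtain ⟨h1, h2⟩ := hp t ht
      have := hwS' t h2
      exact Finset.mem_coe.2 (mem_rect.2 (by omega))
    exact ⟨a, ⟨Finset.mem_coe.1 (hpS a p.start_mem_support), by omega⟩, e,
      ⟨Finset.mem_coe.1 (hpS e p.end_mem_support), he⟩,
      mem_openConnIn_of_walk p hpS fun x hx => hwω x (hpe x hx)⟩
  · -- exit through the bottom side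
    right; right; right
    obtain ⟨a, p, ha, hp, hpe⟩ := exists_tail_walk (fun x : Site 2 => -x 1)
      (fun x y h => by have := (sub_le_one_of_adj h 1).2; omega) w
      (n := -(c 1 - N)) (by omega) (by omega)
    have hpS : ∀ t ∈ p.support, t ∈ (↑(rect[(c 0 - R), (c 0 + R), (c 1 - R), (c 1 - N)]) : Set (Site 2)) := by
      intro t ht
      obtain ⟨h1, h2⟩ := hp t ht
      have := hwS' t h2
      exact Finset.mem_coe.2 (mem_rect.2 (by omega))
    refine ⟨e, ⟨Finset.mem_coe.1 (hpS e p.end_mem_support), he⟩, a,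
      ⟨Finset.mem_coe.1 (hpS a p.start_mem_support), by omega⟩, ?_⟩
    rw [openConnIn_comm]
    exact mem_openConnIn_of_walk p hpS fun x hx => hwω x (hpe x hx)
  · -- exit through the top side
    right; right; left
    obtain ⟨a, p, ha, hp, hpe⟩ := exists_tail_walk (fun x : Site 2 => x 1)
      (fun x y h => by have := (sub_le_one_of_adj h 1).1; omega) w
      (n := c 1 + N) (by omega) (by omega)
    have hpS : ∀ t ∈ p.support, t ∈ (↑(rect[(c 0 - R), (c 0 + R), (c 1 + N), (c 1 + R)]) : Set (Site 2)) := by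
      intro t ht
      obtain ⟨h1, h2⟩ := hp t ht
      have := hwS' t h2
      exact Finset.mem_coe.2 (mem_rect.2 (by omega))
    exact ⟨a, ⟨Finset.mem_coe.1 (hpS a p.start_mem_support), by omega⟩, e,
      ⟨Finset.mem_coe.1 (hpS e p.end_mem_support), he⟩,
      mem_openConnIn_of_walk p hpS fun x hx => hwω x (hpe x hx)⟩

/-- **Monotonicity of horizontal crossings in the rectangle** (on lattice configurations): a
horizontal crossing of `[a, b] × [lo, hi]` contains one of `[a', b'] × [lo', hi']` whenever
`a ≤ a' ≤ b' ≤ b`, `lo' ≤ lo`, `hi ≤ hi'`. -/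
theorem hCross_mono {ω : BondConfig (Site 2)} (hω : ω ⊆ (zdGraph 2).edgeSet)
    {a b lo hi a' b' lo' hi' : ℤ} (haa' : a ≤ a') (hab' : a' ≤ b') (hbb' : b' ≤ b)
    (hlo : lo' ≤ lo) (hhi : hi ≤ hi') (h : ω ∈ hCross[a, b, lo, hi]) : ω ∈ hCross[a', b', lo', hi'] := by
  obtain ⟨s, ⟨hs, hs0⟩, e, ⟨he, he0⟩, hconn⟩ := h
  obtain ⟨w, hwS, hwω⟩ := exists_walk_of_mem_openConnIn hω hconn
  have hwS' : ∀ t ∈ w.support, a ≤ t 0 ∧ t 0 ≤ b ∧ lo ≤ t 1 ∧ t 1 ≤ hi :=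
    fun t ht => mem_rect.1 (Finset.mem_coe.1 (hwS t ht))
  -- head up to the first visit of `{x₀ = b'}`
  obtain ⟨b₁, p₁, hb₁, hp₁, hp₁e⟩ := exists_head_walk (fun x : Site 2 => x 0)
    (fun x y h => by have := (sub_le_one_of_adj h 0).1; omega) w
    (n := b') (by omega) (by omega)
  rcases eq_or_lt_of_le hab' with hab | hab
  · -- degenerate rectangle `a' = b'`: the vertex `b₁` is a crossing by itself
    subst hab
    have hmem : b₁ ∈ rect[a', a', lo', hi'] := by
      have := hwS' b₁ (hp₁ b₁ p₁.end_mem_support).2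
      rw [mem_rect]; omega
    exact ⟨b₁, ⟨hmem, hb₁⟩, b₁, ⟨hmem, hb₁⟩, openConnIn_refl (Finset.mem_coe.2 hmem)⟩
  · -- tail of the head after its last visit of `{x₀ = a'}`
    obtain ⟨a₂, p₂, ha₂, hp₂, hp₂e⟩ := exists_tail_walk (fun x : Site 2 => x 0)
      (fun x y h => by have := (sub_le_one_of_adj h 0).1; omega) p₁
      (n := a') (by omega) (by omega)
    have hp₂S : ∀ t ∈ p₂.support, t ∈ (↑(rect[a', b', lo', hi']) : Set (Site 2)) := by
      intro t ht
      obtain ⟨h1, h2⟩ := hp₂ t ht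
      obtain ⟨h3, h4⟩ := hp₁ t h2
      have := hwS' t h4
      exact Finset.mem_coe.2 (mem_rect.2 (by omega))
    exact ⟨a₂, ⟨Finset.mem_coe.1 (hp₂S a₂ p₂.start_mem_support), ha₂⟩, b₁,
      ⟨Finset.mem_coe.1 (hp₂S b₁ p₂.end_mem_support), hb₁⟩,
      mem_openConnIn_of_walk p₂ hp₂S fun x hx => hwω x (hp₁e x (hp₂e x hx))⟩


/-! ### Translations and the transposition acting on crossing events -/

/-- Translating a rectangle. -/
theorem image_shift_rect (v : Site 2) (a b lo hi : ℤ) :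
    (Site.shift v) '' (↑(rect[a, b, lo, hi]) : Set (Site 2)) =
      ↑(rect[(a + v 0), (b + v 0), (lo + v 1), (hi + v 1)]) := by
  ext x
  simp only [Set.mem_image, Finset.mem_coe, mem_rect, Site.shift_apply]
  constructor
  · rintro ⟨y, hy, rfl⟩
    simp only [Pi.add_apply]; omega
  · intro hx
    refine ⟨x - v, ?_, sub_add_cancel x v⟩
    simp only [Pi.sub_apply]; omega

/-- Translating a vertical side `{x₀ = t}` of a rectangle. -/
theorem image_shift_side0 (v : Site 2) (a b lo hi t : ℤ) :
    (Site.shift v) '' {x : Site 2 | x ∈ rect[a, b, lo, hi] ∧ x 0 = t} =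
      {x | x ∈ rect[(a + v 0), (b + v 0), (lo + v 1), (hi + v 1)] ∧ x 0 = t + v 0} := by
  ext x
  simp only [Set.mem_image, mem_setOf_eq, mem_rect, Site.shift_apply]
  constructor
  · rintro ⟨y, hy, rfl⟩
    simp only [Pi.add_apply]; omega
  · intro hx
    refine ⟨x - v, ?_, sub_add_cancel x v⟩
    simp only [Pi.sub_apply]; omega

/-- Translating a horizontal side `{x₁ = t}` of a rectangle. -/
theorem image_shift_side1 (v : Site 2) (a b lo hi t : ℤ) :
    (Site.shift v) '' {x : Site 2 | x ∈ rect[a, b, lo, hi] ∧ x 1 = t} =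
      {x | x ∈ rect[(a + v 0), (b + v 0), (lo + v 1), (hi + v 1)] ∧ x 1 = t + v 1} := by
  ext x
  simp only [Set.mem_image, mem_setOf_eq, mem_rect, Site.shift_apply]
  constructor
  · rintro ⟨y, hy, rfl⟩
    simp only [Pi.add_apply]; omega
  · intro hx
    refine ⟨x - v, ?_, sub_add_cancel x v⟩
    simp only [Pi.sub_apply]; omega

/-- Translating the boundary of a rectangle. -/
theorem image_shift_sphere (v : Site 2) (a b lo hi : ℤ) :
    (Site.shift v) '' {x : Site 2 | x ∈ rect[a, b, lo, hi] ∧ (x 0 = a ∨ x 0 = b ∨ x 1 = lo ∨ x 1 = hi)} =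
      {x | x ∈ rect[(a + v 0), (b + v 0), (lo + v 1), (hi + v 1)] ∧
        (x 0 = a + v 0 ∨ x 0 = b + v 0 ∨ x 1 = lo + v 1 ∨ x 1 = hi + v 1)} := by
  ext x
  simp only [Set.mem_image, mem_setOf_eq, mem_rect, Site.shift_apply]
  constructor
  · rintro ⟨y, hy, rfl⟩
    simp only [Pi.add_apply]; omega
  · intro hx
    refine ⟨x - v, ?_, sub_add_cancel x v⟩
    simp only [Pi.sub_apply]; omega

/-- **Translation of horizontal crossings**: `{ω | ω + v ∈ H([a, b] × [lo, hi] + v)} = H([a, b] × [lo, hi])`. -/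
theorem preimage_shift_hCross (v : Site 2) (a b lo hi : ℤ) :
    BondConfig.relabel (sym2Equiv (Site.shift v)) ⁻¹' hCross[(a + v 0), (b + v 0), (lo + v 1), (hi + v 1)] =
      hCross[a, b, lo, hi] := by
  rw [← image_shift_rect, ← image_shift_side0, ← image_shift_side0]
  exact preimage_relabel_openCrossing (Site.shift v) _ _ _

/-- **Translation of vertical crossings.** -/
theorem preimage_shift_vCross (v : Site 2) (a b lo hi : ℤ) :
    BondConfig.relabel (sym2Equiv (Site.shift v)) ⁻¹' vCross[(a + v 0), (b + v 0), (lo + v 1), (hi + v 1)] =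
      vCross[a, b, lo, hi] := by
  rw [← image_shift_rect, ← image_shift_side1, ← image_shift_side1]
  exact preimage_relabel_openCrossing (Site.shift v) _ _ _

/-- **Translation of annulus events**: `{ω | ω + v ∈ A(c + v; N, R)} = A(c; N, R)`. -/
theorem preimage_shift_annulusCross (v c : Site 2) (N R : ℕ) :
    BondConfig.relabel (sym2Equiv (Site.shift v)) ⁻¹' annulusCross[(c + v), N, R] = annulusCross[c, N, R] := by
  have e1 : ∀ t : ℤ, (c + v) 0 - t = c 0 - t + v 0 := fun t => by rw [Pi.add_apply]; ring
  have e2 : ∀ t : ℤ, (c + v) 0 + t = c 0 + t + v 0 := fun t => by rw [Pi.add_apply]; ring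
  have e3 : ∀ t : ℤ, (c + v) 1 - t = c 1 - t + v 1 := fun t => by rw [Pi.add_apply]; ring
  have e4 : ∀ t : ℤ, (c + v) 1 + t = c 1 + t + v 1 := fun t => by rw [Pi.add_apply]; ring
  simp only [e1, e2, e3, e4]
  rw [← image_shift_rect, ← image_shift_rect, ← image_shift_sphere]
  exact preimage_relabel_openCrossing (Site.shift v) _ _ _

/-- Transposing a rectangle. -/
theorem image_transpose_rect (a b lo hi : ℤ) :
    (transposeIso.toEquiv : Site 2 ≃ Site 2) '' (↑(rect[a, b, lo, hi]) : Set (Site 2)) = ↑(rect[lo, hi, a, b]) := by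
  ext x
  simp only [Set.mem_image, Finset.mem_coe, mem_rect, RelIso.coe_fn_toEquiv]
  constructor
  · rintro ⟨y, hy, rfl⟩
    simp only [transposeIso_apply_zero, transposeIso_apply_one]; omega
  · intro hx
    refine ⟨transposeIso x, ?_, ?_⟩
    · simp only [transposeIso_apply_zero, transposeIso_apply_one]; omega
    · ext i; fin_cases i <;> simp

/-- Transposing a horizontal side gives a vertical side. -/
theorem image_transpose_side1 (a b lo hi t : ℤ) :
    (transposeIso.toEquiv : Site 2 ≃ Site 2) '' {x : Site 2 | x ∈ rect[a, b, lo, hi] ∧ x 1 = t} =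
      {x | x ∈ rect[lo, hi, a, b] ∧ x 0 = t} := by
  ext x
  simp only [Set.mem_image, mem_setOf_eq, mem_rect, RelIso.coe_fn_toEquiv]
  constructor
  · rintro ⟨y, hy, rfl⟩
    simp only [transposeIso_apply_zero, transposeIso_apply_one]; omega
  · intro hx
    refine ⟨transposeIso x, ?_, ?_⟩
    · simp only [transposeIso_apply_zero, transposeIso_apply_one]; omega
    · ext i; fin_cases i <;> simp

/-- **Transposition exchanges vertical and horizontal crossings**:
`{ω | ωᵀ ∈ H([lo, hi] × [a, b])} = V([a, b] × [lo, hi])`. -/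
theorem preimage_transpose_hCross (a b lo hi : ℤ) :
    BondConfig.relabel (sym2Equiv (transposeIso.toEquiv : Site 2 ≃ Site 2)) ⁻¹' hCross[lo, hi, a, b] =
      vCross[a, b, lo, hi] := by
  rw [← image_transpose_rect, ← image_transpose_side1, ← image_transpose_side1]
  exact preimage_relabel_openCrossing _ _ _ _

/-- **Headline of this support file** (registered sub-stub `stub_finiteSizeCriteria_pieces` of
`stub_finiteSizeCriteria`): translates of lattice rectangles are lattice rectangles (`image_shift_rect`). -/
theorem stub_finiteSizeCriteria_pieces :
    ∀ (v : Site 2) (a b lo hi : ℤ), (Site.shift v) '' (↑(Finset.Icc ![a, lo] ![b, hi]) : Set (Site 2)) = ↑(Finset.Icc ![a + v 0, lo + v 1] ![b + v 0, hi + v 1]) :=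
  fun v a b lo hi => image_shift_rect v a b lo hi

end FSC

end Summit.CriticalPhenomena.CardyFormulaZ2.Cruxes.CriticalPathRSW.FiniteSizeEnvelope
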